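import Mathlib
import HarnessLib
import Summits.HubbardSuperconductivity.HubbardSuperconductivity.Theorems.KLProgrammeKLRegimeEngineTowerLevLawFOfBlocksZXRows
import Summits.HubbardSuperconductivity.HubbardSuperconductivity.Theorems.KLProgrammeKLRegimeEngineTowerLevReadoutFitFBornSharp
import Summits.HubbardSuperconductivity.HubbardSuperconductivity.Theorems.KLProgrammeKLRegimeKernelNormsLevelsFloorTracks
import Summits.HubbardSuperconductivity.HubbardSuperconductivity.Theorems.KLProgrammeKLRegimeEngineTowerPartialIncrLevStepF

/-!
# Route `KLProgramme` — crux K3 ENGINE (stmt-HubbardSuperconductivity-20437 `KLRegimeEngineV17F2`), stub (b) v2, THE LEVELS PACKAGE (ℓ): «(ℓ)-REKEY-ROWS»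
# LINK 2 — closer‴♯ KEYED ON THE BASE DATUM AS ROWS (cell gate-hubbard-kl, seat gate-hubbard-kl-p3 g22, pen (R359)(A); the rows-twin of p4 g21's
# `kernelNormsLevels_readoutF_of_blocks_link_sharp` (…TowerLevReadoutCloseFLinkSharp, p692689): `klTowerBLevF_le_law_lev_of_blocks_ZX_rows` (link 1) ∘ RO-4‴♯
# `readoutLevF_le_levelsRHS_of_bornRows_sharp` ∘ `kernelNormsLevels_of_floorTracks`)

WHY.  closer‴♯ takes the tower's base datum from p3's weighted grid step at `(Λ_d, F_{d−1})` (its §(1) rebuilds `N_b` from the literal budget) and feeds it both to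
the law (`…_of_blocks_ZX`) and to RO-4‴♯'s base binders.  With link 1 the law is keyed on ROWS, and RO-4‴♯ already takes rows; so here the base-datum group of the
binder list is `_of_le_B_tokX`'s (`B Ab Qb ι₂ X`, `0 < Ab`, `Ab' ι₂' X'` discounted, `Nb ≥ 0`, `hcar`, `hlawb` at `λ = B·ε_j`) plus the binder `Z^{K}_{Λ_d} ≠ 0`, the
grid-step group and §(1) are gone, and everything else — link data, pins, (I5)-F choices, blocking, `B ≥ B₀`, imports, cell, doors, the read-out slice data,
`Aro Qro Qtot`, sharp `Atot`, the `CE` threshold, caps, six-leg cell — and the conclusion `KernelNormsLevels L M P Qe β U μ K j` are byte-identical.  The rows come,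
on `K_n`, from p3 g22's `baseLawF_blockZeroF_klEng[_of_wgridStep]` (…TowerBlockZeroBaseFKlEng) with `Nb := klTowerMeasLev … d 1`.

* **`kernelNormsLevels_readoutF_of_blocks_link_sharp_rows`**.
Composition of landed theorems only; nothing about the model is asserted beyond them; nothing asserts (ℓ), any stub, K3 or superconductivity.
References: BGM 2006 §2.8 (2.76)–(2.84), (2.93)–(2.98), Lemma 2.5, §3 (3.2)–(3.8) [cite: BenfattoGiulianiMastropietro2006].
-/


noncomputable section

namespace Summit.HubbardSuperconductivity.HubbardSuperconductivity.Theorems.EngineV8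

set_option linter.dupNamespace false -- summit = problem name (single-conjunct summit), D-0017

open Classical
open Real Finset Literature.MathematicalPhysics.QuantumLattice Literature.Probability.LatticeModels GrassmannAlgebra
open Literature.Probability.LatticeModels.BattleFederbush
open Literature.MathematicalPhysics.QuantumLattice.FermiRG
open Summit.HubbardSuperconductivity.HubbardSuperconductivity.Theorems.KLProgrammeLegKernels
open Summit.HubbardSuperconductivity.HubbardSuperconductivity.Theorems.KLRegimeSplit
open Summit.HubbardSuperconductivity.HubbardSuperconductivity.Theorems.KLRegimeWick
open Summit.HubbardSuperconductivity.HubbardSuperconductivity.Theorems.TorusFourierL2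
open Summit.HubbardSuperconductivity.HubbardSuperconductivity.Theorems.DispersionFlow

variable {L M : ℕ} [NeZero L] [NeZero M]

set_option maxHeartbeats 400000 in -- two ~150-binder compositions + the base datum in one declaration
/-- **`KernelNormsLevels` AT A READ-OUT LEVEL OF A BLOCK, LINK ROWS KEPT, BASE DATUM AS ROWS — SHARP ENVELOPE** («(ℓ)-REKEY-ROWS» link 2; rows-twin of
`kernelNormsLevels_readoutF_of_blocks_link_sharp`): see the module docstring for the binder changes; conclusion `KernelNormsLevels L M P Qe β U μ K j`.
[cite: BenfattoGiulianiMastropietro2006, §2.8 (2.76)-(2.84), Lemma 2.5 (2.98), §3 (3.2)-(3.8)] -/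
theorem kernelNormsLevels_readoutF_of_blocks_link_sharp_rows :
    ∃ C₁ C₂ C₁' C₂' Cinc Dinc : ℝ, 0 < C₁ ∧ 0 < C₂ ∧ 0 < C₁' ∧ 0 < C₂' ∧ 0 < Cinc ∧ 1 ≤ Dinc ∧
    ∀ R : RenConsts, R.WF2 → ∃ c₃' : ℝ, 0 < c₃' ∧ ∃ U₀' : ℝ, 0 < U₀' ∧
      ∀ (P : SplitConsts) (c : ℝ), P.WF → 0 < c → c ≤ klEngC₃6 P R → c ≤ c₃' →
      ∀ μ ∈ klWindowC, ∀ U : ℝ, 0 < U → U ≤ klEngU₀9 P R c → U ≤ U₀' → ∀ β : ℝ, klBetaMin ≤ β → β ≤ Real.exp (c / U ^ 2) →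
      ∀ K : TrigPolyC4v, FrameOK R U (nScales β) μ K → ∀ (L M : ℕ) [NeZero L] [NeZero M],
      klEngL₃ β U ≤ L → klEngM₃ β U L ≤ M → ∀ d Kb D : ℕ, 2 ≤ d → d * Kb - 1 ≤ nScales β + 1 → 3 ≤ D →
      ∀ (cc : ℝ) (n j : ℕ), IsKLRegime U cc (-(n : ℤ)) → j ≤ n →
      -- the read-out level `j` inside the block `Kb ≥ 1` («(ℓ)-READOUT-F»)
      1 ≤ Kb → d * Kb ≤ j → j ≤ nScales β + 1 →
      ∀ (B Ab Qb ι₂ X : ℝ), 1 ≤ B → 0 < Ab → 0 ≤ Qb → 0 ≤ ι₂ → 0 ≤ X →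
      -- the B-discounted data (equational binders)
      ∀ (Ab' ι₂' X' : ℝ), Ab' = Ab / B ^ 2 → ι₂' = ι₂ / B → X' = X / B ^ 2 →
      -- the BASE DATUM AS ROWS at the family `F_{d−1}` and its unit law in the discounted shape, at `λ = B·ε_j` (NO grid step)
      ∀ Nb : Fin 5 → ℕ → ℝ, (∀ t p, 0 ≤ Nb t p) →
        (∀ (t : Fin 5) (p : ℕ) (Ωe' : Fin (2 * p) → Option (SectorLeg (sectorCount (d - 1)))), levelCount Ωe' = (t : ℕ) + 1 →
          klLevNormOf L M β μ K (d - 1) (2 * p) (klTowerInput L M β U μ K d 1) Ωe' ≤ Nb t p) →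
        (∀ (t : Fin 5) (p : ℕ), 3 ≤ p → Nb t p / klLevUnitF β M t p (d - 1) ≤ Ab' * (B * epsCoupling P U j) ^ (p - 1) * Qb ^ p) →
      -- the partition function at the tower's base `Λ_d` (a binder)
      hubbardEffPartitionFnCT L M β U μ 0 K (klScale klE0 d) ≠ 0 →
      -- the floor LINK data («(ℓ)-LINK-UNIFORM-F», k3c2-p3 g14): per-block Gram, decay and analysis-overlap rows at k-free bounds (NO partition function)
      ∀ (κb αb crb ccb : ℝ), 0 < κb → 0 < αb → 0 < crb → 0 < ccb →
      ∀ (κl αl : ℕ → ℝ), (∀ k, 1 ≤ k → k < Kb → 0 < κl k) → (∀ k, 1 ≤ k → k < Kb → κl k ^ 2 * (8 : ℝ) ^ (d * k) ≤ κb ^ 2) →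
      (∀ k, 1 ≤ k → k < Kb → αl k ≤ αb * (4 : ℝ) ^ (d * k)) →
      (∀ k, 1 ≤ k → k < Kb → IsGramBoundedR ((sectorSubMatrix L M β (bgmFatMultiplier L M klE0 β (nambuXiCT L μ K) (d * k - 1))).transpose *
        hubbardCovSliceCT L M β μ 0 K (klScale klE0 (d * (k + 1))) (klScale klE0 (d * k)) *
          sectorSubMatrix L M β (bgmFatMultiplier L M klE0 β (nambuXiCT L μ K) (d * k - 1))) (κl k)) →
      (∀ k, 1 ≤ k → k < Kb → ∀ X, ∑ Y, ‖((sectorSubMatrix L M β (bgmFatMultiplier L M klE0 β (nambuXiCT L μ K) (d * k - 1))).transpose *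
        hubbardCovSliceCT L M β μ 0 K (klScale klE0 (d * (k + 1))) (klScale klE0 (d * k)) *
          sectorSubMatrix L M β (bgmFatMultiplier L M klE0 β (nambuXiCT L μ K) (d * k - 1))) X Y‖ ≤ αl k) →
      (∀ k, 1 ≤ k → k < Kb → ∀ Y, ∑ X, ‖((sectorSubMatrix L M β (bgmFatMultiplier L M klE0 β (nambuXiCT L μ K) (d * k - 1))).transpose *
        hubbardCovSliceCT L M β μ 0 K (klScale klE0 (d * (k + 1))) (klScale klE0 (d * k)) *
          sectorSubMatrix L M β (bgmFatMultiplier L M klE0 β (nambuXiCT L μ K) (d * k - 1))) X Y‖ ≤ αl k) →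
      (∀ k, 1 ≤ k → k < Kb → ∀ X'', ∑ X', ‖(sectorAnalysisMatrix L M β (klAnisoFamily L M β μ K klE0 (d * k)) *
        sectorSubMatrix L M β (bgmFatMultiplier L M klE0 β (nambuXiCT L μ K) (d * k - 1))) X'' X'‖ ≤ crb) →
      (∀ k, 1 ≤ k → k < Kb → ∀ X', ∑ X'', ‖(sectorAnalysisMatrix L M β (klAnisoFamily L M β μ K klE0 (d * k)) *
        sectorSubMatrix L M β (bgmFatMultiplier L M klE0 β (nambuXiCT L μ K) (d * k - 1))) X'' X'‖ ≤ ccb) →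
      (∀ k, 1 ≤ k → k < Kb → Fintype.card (SpaceTimeIdx L M × SectorLeg (sectorCount (d * k - 1))) / 2 ≤ D) →
      -- the law's six names PINNED by the link (equational binders), and the import `ι₁`
      ∀ (W Z σ Φ ψ τ ι₁ : ℝ), W = 64 * (27 : ℝ) ^ 4 * exp 2 * crb / ccb → Z = exp 4 * ccb ^ 2 * imagTimeWeight β M ^ 2 / 8 →
        σ = κb ^ 2 / (exp 4 * ccb ^ 2) → Φ = 9 * αb * ccb / ((27 : ℝ) ^ 5 * exp 1 * κb ^ 2 * crb) → ψ = exp 4 * ccb ^ 2 / κb ^ 2 →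
        τ = exp 2 * κb ^ 2 / ccb ^ 2 → 0 ≤ ι₁ →
      ∀ (ρk Q' Q κA Yb Y A A' ι₃ : ℝ), ρk = max 4 (2 * τ * ψ) → Q' = Z * Qb + 1 → Q = ρk * Q' →
        κA = W * ((27 : ℝ) ^ 5 * (C₁ / C₂) * (8 : ℝ) ^ (d - 1)) →
        Yb = ι₂ / (2 * Q') + W * Z ^ 3 * X / (4 * Q' ^ 2) + (W * (27 : ℝ) ^ 5 * Ab + κA * Ab) * Q' / 2 →
        Y = ι₂' / (2 * Q') + W * Z ^ 3 * X' / (4 * Q' ^ 2) + (W * (27 : ℝ) ^ 5 * Ab' + κA * Ab') * Q' / 2 →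
        A = 2 * Y * (1 - ((2 : ℝ) ^ d)⁻¹) / (κA * Q') →
        A' = (W * (27 : ℝ) ^ 5 * Ab' + κA * Ab') + 2 * Y / Q' → ι₃ = W * Z ^ 3 * X' + A' * Q' ^ 3 →
      max 1 Z * C₂ ^ 2 * max 4 (2 * τ * ψ) ≤ (2 : ℝ) ^ (d - 1) →
      max 1 (max (8 * Φ * τ * Yb) (128 * exp 1 * ψ ^ 3 * τ ^ 4 * Φ * κA * Yb / ((1 - ((2 : ℝ) ^ d)⁻¹) * ρk ^ 3))) ≤ B →
      (∀ k, 1 ≤ k → k ≤ Kb → W * Z ^ 1 * klTowerMuLevF L M β U μ K d k 1 ≤ ι₁ * (B * epsCoupling P U j)) →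
      (∀ k, 1 ≤ k → k ≤ Kb → W * Z ^ 2 * klTowerMuLevF L M β U μ K d k 2 ≤ ι₂' * (B * epsCoupling P U j)) →
      (∀ k, 2 ≤ k → k ≤ Kb → klTowerMuLevAtF L M β U μ K d 0 k 3 ≤ X' * (B * epsCoupling P U j) ^ 2) →
      U ≤ min 1 (min (1 / (8 * σ * Q' + 1)) (min (1 / (2 * exp 1 * τ * Q' + 1)) (min (1 / (4 * Φ * τ * ι₁ + 1))
        (min (1 / (2 * (Φ * (exp 1 * τ * ι₁ + (exp 1 * τ) ^ 2 * ι₂' + (exp 1 * τ) ^ 3 * ι₃ + A' * (exp 1 * τ * Q') ^ 2 / 2)) + 1))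
          (min (A * Q ^ 3 / (16 * σ * Q' * A' * (4 * Q') ^ 3 + A * Q ^ 3))
            (A * Q ^ 3 / (16 * exp 1 * ψ * (2 * τ * ψ * Q') ^ 2 * Φ * τ ^ 2 * ι₁ ^ 2 + A * Q ^ 3))))))) / (2 * B * P.Klam + 1) →
      cc ≤ min 1 (min (1 / (8 * σ * Q' + 1)) (min (1 / (2 * exp 1 * τ * Q' + 1)) (min (1 / (4 * Φ * τ * ι₁ + 1))
        (min (1 / (2 * (Φ * (exp 1 * τ * ι₁ + (exp 1 * τ) ^ 2 * ι₂' + (exp 1 * τ) ^ 3 * ι₃ + A' * (exp 1 * τ * Q') ^ 2 / 2)) + 1))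
          (min (A * Q ^ 3 / (16 * σ * Q' * A' * (4 * Q') ^ 3 + A * Q ^ 3))
            (A * Q ^ 3 / (16 * exp 1 * ψ * (2 * τ * ψ * Q') ^ 2 * Φ * τ ^ 2 * ι₁ ^ 2 + A * Q ^ 3))))))) * Real.log 4 / (2 * B * P.Klam + 1) →
      -- the partial slice `(Λ_j, Λ_{dKb}]` of the read-out block: Gram, decay, analysis overlaps at block `Kb`, degree cap (k3c2-p3's RO-2 (d′) data)
      ∀ (κj αj : ℝ), 0 < κj → κj ^ 2 * (8 : ℝ) ^ (d * Kb) ≤ κb ^ 2 → αj ≤ αb * (4 : ℝ) ^ (d * Kb) →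
      IsGramBoundedR ((sectorSubMatrix L M β (bgmFatMultiplier L M klE0 β (nambuXiCT L μ K) (d * Kb - 1))).transpose *
        hubbardCovSliceCT L M β μ 0 K (klScale klE0 j) (klScale klE0 (d * Kb)) *
          sectorSubMatrix L M β (bgmFatMultiplier L M klE0 β (nambuXiCT L μ K) (d * Kb - 1))) κj →
      (∀ X, ∑ Y, ‖((sectorSubMatrix L M β (bgmFatMultiplier L M klE0 β (nambuXiCT L μ K) (d * Kb - 1))).transpose *
        hubbardCovSliceCT L M β μ 0 K (klScale klE0 j) (klScale klE0 (d * Kb)) *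
          sectorSubMatrix L M β (bgmFatMultiplier L M klE0 β (nambuXiCT L μ K) (d * Kb - 1))) X Y‖ ≤ αj) →
      (∀ Y, ∑ X, ‖((sectorSubMatrix L M β (bgmFatMultiplier L M klE0 β (nambuXiCT L μ K) (d * Kb - 1))).transpose *
        hubbardCovSliceCT L M β μ 0 K (klScale klE0 j) (klScale klE0 (d * Kb)) *
          sectorSubMatrix L M β (bgmFatMultiplier L M klE0 β (nambuXiCT L μ K) (d * Kb - 1))) X Y‖ ≤ αj) →
      (∀ X'', ∑ X', ‖(sectorAnalysisMatrix L M β (klAnisoFamily L M β μ K klE0 (d * Kb)) *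
        sectorSubMatrix L M β (bgmFatMultiplier L M klE0 β (nambuXiCT L μ K) (d * Kb - 1))) X'' X'‖ ≤ crb) →
      (∀ X', ∑ X'', ‖(sectorAnalysisMatrix L M β (klAnisoFamily L M β μ K klE0 (d * Kb)) *
        sectorSubMatrix L M β (bgmFatMultiplier L M klE0 β (nambuXiCT L μ K) (d * Kb - 1))) X'' X'‖ ≤ ccb) →
      Fintype.card (SpaceTimeIdx L M × SectorLeg (sectorCount (d * Kb - 1))) / 2 ≤ D →
      -- the read-out constants (equational binders), the public constant's threshold, the degree cap, the six-leg cell at level `j`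
      ∀ (Aro Qro Qtot Atot : ℝ), Aro = (27 : ℝ) ^ 5 * (C₁' / C₂') * (Ab' + (8 : ℝ) ^ (d - 1) * (A / (1 - ((2 : ℝ) ^ d)⁻¹))) →
        Qro = C₂' ^ 2 * max Qb (((2 : ℝ) ^ (d - 1))⁻¹ * max Q Qb) → Qtot = Dinc * max 1 (max Qro (max (4 * Q') (2 * τ * ψ * Q'))) →
        Atot = Aro + Cinc * (A' * (4 * σ * (B * epsCoupling P U j) * Q' / (1 - 4 * σ * (B * epsCoupling P U j) * Q')) +
          exp 1 * (τ * (ι₁ * (B * epsCoupling P U j) + ι₂' / (2 * Q') + ι₃ / (4 * Q' ^ 2) + A' * Q' / 4)) *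
            (Φ * (τ * (ι₁ * (B * epsCoupling P U j) + ι₂' / (2 * Q') + ι₃ / (4 * Q' ^ 2) + A' * Q' / 4)) /
              (1 - Φ * (τ * (ι₁ * (B * epsCoupling P U j) + ι₂' / (2 * Q') + ι₃ / (4 * Q' ^ 2) + A' * Q' / 4)))) / (2 * τ * Q')) →
      ∀ Qe : EngConsts, Qtot * imagTimeWeight β M ^ 2 * B * max 1 (Atot / imagTimeWeight β M) ≤ Qe.CE →
      Fintype.card (HubbardFieldIdx L M) ≤ 2 * D + 1 →
      (∀ Ωe : Fin (2 * 3) → Option (SectorLeg (sectorCount j)), levelCount Ωe = 1 →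
        klAnisoLegKernelNormAt L M β U μ K klE0 j (2 * 3) Ωe ≤ Qe.CE ^ 3 * (epsCoupling P U j) ^ 2 * (2 : ℝ) ^ ((4 : ℤ) * j)) →
      KernelNormsLevels L M P Qe β U μ K j := by
  obtain ⟨C₁, C₂, hC₁, hC₂, hL⟩ := klTowerBLevF_le_law_lev_of_blocks_ZX_rows
  obtain ⟨C₁', C₂', Cinc, Dinc, hC₁', hC₂', hCinc, hDinc, hR⟩ := readoutLevF_le_levelsRHS_of_bornRows_sharp
  refine ⟨C₁, C₂, C₁', C₂', Cinc, Dinc, hC₁, hC₂, hC₁', hC₂', hCinc, hDinc, fun R hR2 => ?_⟩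
  obtain ⟨c₃, hc₃, U₀, hU₀, hL'⟩ := hL R hR2
  obtain ⟨c₃r, hc₃r, U₀r, hU₀r, hR'⟩ := hR R hR2
  refine ⟨min c₃ c₃r, lt_min hc₃ hc₃r, min U₀ U₀r, lt_min hU₀ hU₀r, ?_⟩
  intro P c hP hc hc6 hc₃' μ hμ U hU hU9 hU₀' β hβmin hβc K hK L M _ _ hL3 hM3 d Kb D hd hKbN hD cc n j hreg hj hKb1 hKbj hjN
    B Ab Qb ι₂ X hB hAb hQb hι₂ hX Ab' ι₂' X' hAb' hι₂' hX' Nb hNb0 hcar hlawb hZd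
    κb αb crb ccb hκb hαb hcrb hccb κl αl hκl hκκb hααb hGBl hrowl hcoll hrowl' hcoll' hDl
    W Z σ Φ ψ τ ι₁ hW hZ hσ hΦ hψ hτ hι₁ ρk Q' Q κA Yb Y A A' ι₃ hρk hQ' hQ hκA hYb hY hA hA' hι₃ hblock hBle himp₁ himp₂ hcell hUdoor hcdoor
    κj αj hκj hκκbj hααbj hGBj hrowj hcolj hrowK hcolK hDK Aro Qro Qtot Atot hAro hQro hQtot hAtot Qe hCE hcard hsix
  -- (0) the law with its exports on the blocks up to `Kb` («(ℓ)-Z-THREAD» + «(ℓ)-CHERNOFF-EXPORT»)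
  obtain ⟨hZall, hlaw, hcher, hsmall⟩ := hL' P c hP hc hc6 (hc₃'.trans (min_le_left _ _)) μ hμ U hU hU9 (hU₀'.trans (min_le_left _ _)) β hβmin hβc K hK
    L M hL3 hM3 d Kb D hd hKbN hD cc n j hreg hj B Ab Qb ι₂ X hB hAb hQb hι₂ hX Ab' ι₂' X' hAb' hι₂' hX' Nb hNb0 hcar hlawb hZd
    κb αb crb ccb hκb hαb hcrb hccb κl αl hκl hκκb hααb hGBl hrowl hcoll hrowl' hcoll' hDl
    W Z σ Φ ψ τ ι₁ hW hZ hσ hΦ hψ hτ hι₁ ρk Q' Q κA Yb Y A A' ι₃ hρk hQ' hQ hκA hYb hY hA hA' hι₃ hblock hBle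
    (fun k hk1 hk => himp₁ k hk1 hk.le) (fun k hk1 hk => himp₂ k hk1 hk.le) hcell hUdoor hcdoor
  -- (1) the base datum at `F_{d−1}` is a ROW here (no grid step)
  have hβ : 0 < β := KLRegimeSplit.pos_of_klBetaMin_le hβmin
  have hK1 : 1 ≤ P.Klam := hP.1
  have hK0 : 0 < P.Klam := lt_of_lt_of_le one_pos hK1
  -- (2) signs of the law's names
  have hM0 : (0 : ℝ) < M := Nat.cast_pos.2 (Nat.pos_of_ne_zero (NeZero.ne M))
  have hεpos : 0 < imagTimeWeight β M := by unfold imagTimeWeight; positivity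
  have hWpos : 0 < W := by rw [hW]; positivity
  have hZpos : 0 < Z := by rw [hZ]; positivity
  have hσnn : 0 ≤ σ := by rw [hσ]; positivity
  have hΦnn : 0 ≤ Φ := by rw [hΦ]; positivity
  have hψnn : 0 ≤ ψ := by rw [hψ]; positivity
  have hτpos : 0 < τ := by rw [hτ]; positivity
  have hQ'0 : 0 < Q' := by rw [hQ']; positivity
  have hρk0 : 0 < ρk := by rw [hρk]; exact lt_max_of_lt_left (by norm_num)
  have hQ0 : 0 ≤ Q := by rw [hQ]; positivity
  have hκA0 : 0 < κA := by rw [hκA]; positivity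
  have hAb'0 : 0 ≤ Ab' := by rw [hAb']; positivity
  have hι₂'0 : 0 ≤ ι₂' := by rw [hι₂']; positivity
  have hX'0 : 0 ≤ X' := by rw [hX']; positivity
  have hY0 : 0 ≤ Y := by rw [hY]; positivity
  have h2inv : 0 < 1 - ((2 : ℝ) ^ d)⁻¹ := sub_pos.2 (inv_lt_one_of_one_lt₀ (one_lt_pow₀ (by norm_num) (by omega)))
  have hA0 : 0 ≤ A := by rw [hA]; exact div_nonneg (mul_nonneg (mul_nonneg zero_le_two hY0) h2inv.le) (mul_pos hκA0 hQ'0).le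
  have hA'0 : 0 ≤ A' := by rw [hA']; positivity
  -- (3a) the partial-block step BORN at `F_{dKb}` from the slice data (k3c2-p3's RO-2 (d′)), in the law's named pins
  have hinc :
      ∀ N : ℕ, 1 ≤ N → Φ * towerV D τ (fun m => W * Z ^ m * klTowerMuLevF L M β U μ K d Kb m) < 1 →
        ∀ (t : Fin 5) (q : ℕ) (Ωe : Fin (2 * q + 1 + 1) → Option (SectorLeg (sectorCount (d * Kb)))), levelCount Ωe = (t : ℕ) + 1 →
        klLevNormOf L M β μ K (d * Kb) (2 * q + 1 + 1) (klEffectiveAction L M β U μ K klE0 j - klTowerInput L M β U μ K d Kb) Ωe /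
            klLevUnitF β M t (q + 1) (d * Kb) ≤
          towerFO D σ (fun m => W * Z ^ m * klTowerMuLevF L M β U μ K d Kb m) (q + 1) +
            ∑ n' ∈ Icc 2 N, exp 1 * Φ ^ (n' - 1) * ψ ^ (q + 1) * towerS D τ (fun m => W * Z ^ m * klTowerMuLevF L M β U μ K d Kb m) n' (q + 1) +
            ψ ^ (q + 1) * exp 1 * towerV D τ (fun m => W * Z ^ m * klTowerMuLevF L M β U μ K d Kb m) *
              (Φ * towerV D τ (fun m => W * Z ^ m * klTowerMuLevF L M β U μ K d Kb m)) ^ N /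
              (1 - Φ * towerV D τ (fun m => W * Z ^ m * klTowerMuLevF L M β U μ K d Kb m)) := by
    rw [hW, hZ, hσ, hτ, hψ, hΦ]
    intro N hN hg t q Ωe hΩe
    exact partialIncrLevF_le_kitStep_of_bounds hβ U μ K (by omega) hKb1 (le_trans hd (Nat.le_mul_of_pos_right d hKb1)) hKbj
      (hZall Kb hKb1 le_rfl) hκj hκb hκκbj hGBj hαb hααbj hrowj hcolj hcrb hccb hrowK hcolK hDK hN hg t q Ωe hΩe
  -- (3) the floor read-out on every track (RO-1 + E1 part 7 + units, k3c3-p2's RO-4)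
  have hro := hR' P c hP hc hc6 (hc₃'.trans (min_le_right _ _)) μ hμ U hU hU9 (hU₀'.trans (min_le_right _ _)) β hβmin hβc K hK L M hL3 hM3
    d Kb j D hd hKb1 hKbj hjN hD A B Q Ab' Qb hA0 hB hQ0 hAb'0 hQb Nb hNb0 hcar hlawb hlaw
    W Z σ Φ ψ τ A' Q' ι₁ ι₂' ι₃ hWpos hZpos hσnn hΦnn hψnn hτpos hA'0 hQ'0 (hcher Kb hKb1 le_rfl).1 ((hcher Kb hKb1 le_rfl).2 hD)
    (himp₁ Kb hKb1 le_rfl) (himp₂ Kb hKb1 le_rfl) hsmall.1 hsmall.2.1 hsmall.2.2.1 hsmall.2.2.2.1 hsmall.2.2.2.2 hinc Aro Qro Qtot Atot hAro hQro hQtot hAtot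
    Qe.CE hCE
  -- (4) close on the floor tracks `t = 0, 2, 4` + the six-leg cell, capped at `D` («(ℓ)-RO5-FLOOR-TRACKS»)
  have hQtot0 : 0 ≤ Qtot := by rw [hQtot]; exact mul_nonneg (zero_le_one.trans hDinc) (le_max_of_le_left zero_le_one)
  have hCE0 : 0 ≤ Qe.CE := le_trans (mul_nonneg (by positivity) (le_max_of_le_left zero_le_one)) hCE
  exact kernelNormsLevels_of_floorTracks hβ.le hCE0 hK0.le hD hcard
    (fun t _ p hp hpD hpt Ωe hc => by rw [← klLevNormOf_klEffectiveAction]; exact hro t p hp hpD hpt Ωe hc) hsix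

end Summit.HubbardSuperconductivity.HubbardSuperconductivity.Theorems.EngineV8

end
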